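import Literature.NumberTheory.Sieve.MoebiusShiftedPrimesMinorArcWith
import HarnessLib

/-!
# Möbius on shifted primes — Theorem 1.1 (qualitative part) along the corrected sets `S_c`

Topic `Literature/NumberTheory/Sieve`.  Everything in this file is PROVED; it has no definitions and
introduces no named fact.  It is the companion, for the QUALITATIVE part of Theorem 1.1 of
J. D. Lichtman, *Averages of the Möbius function on shifted primes*, Q. J. Math. 73 (2022) 729–757,
arXiv:2009.08969v2 [Lichtman2020] (the named fact
`Literature.NumberTheory.Sieve.lichtman2020_moebius_shifted_primes_avg` of `MoebiusShiftedPrimes.lean`),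
of `MoebiusShiftedPrimesDecompositionWith.lean` (power range): the deduction "Theorem 1.1 ⇐ Theorem 2.2
+ (2.5)" of `MoebiusShiftedPrimesProofs.lean` re-run along the CORRECTED typical sets
`S_c = lichtmanTypicalWith c` (`MoebiusShiftedPrimesTypical.lean`: first interval
`[(log X)^{cA}, H/(log X)^{4A}]`, `c ≥ 100`, because the printed proof of Proposition 5.1 loses a factor
`V²`), with `c = 100`, `A = 6`, `δ = 1/6`, so `P₁ = (log N)^{600}` and the sieve side still has
`log P₁/log Q₁ → 0` (`rho1_le_with`).

* `lichtman2020_moebius_shifted_primes_avg_of_keyFourierEstimateWith :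
    Lichtman2020_keyFourierEstimateWith → Lichtman2020_shiftedPrimeSieveBound →
    lichtman2020_moebius_shifted_primes_avg` (and the primed form with (2.5) proved);
* the composites along the corrected chain of the tree (`MoebiusShiftedPrimesArcsWith.lean`,
  `MoebiusShiftedPrimesMinorArcWith.lean`, `MoebiusShiftedPrimesMeanSquare.lean`,
  `MoebiusShiftedPrimesDirichletMeanValue.lean`):
  `lichtman2020_moebius_shifted_primes_avg_of_dirichletMeanValueWith` (⇐ Prop 5.1_c + Lemma 4.8) and
  `lichtman2020_moebius_shifted_primes_avg_of_primeCharacterSum_of_liouvilleCharacterSifted`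
  (⇐ Lemma 4.5 + Lemma 4.8: the qualitative Theorem 1.1 rests on exactly the two printed inputs
  Lemma 4.5 (Vinogradov–Korobov for prime character sums) and Lemma 4.8 (fundamental lemma +
  Siegel–Walfisz), every other step being proved in the tree along `S_c`).

## References

* J. D. Lichtman, arXiv:2009.08969v2: Thm 1.1 (PDF p. 3), §2: Lemma 2.1, (2.3)–(2.6), Thm 2.2
  (PDF pp. 7–8) [Lichtman2020].
-/

open Filter Asymptotics Finset MeasureTheory
open scoped Topology

namespace Literature.NumberTheory.Sieve.Lichtman2020

/-- `ρ₁ = log((log N)^{600}) / log(H'/(log N)^{24}) ≤ c` once `log H' ≥ (24 + 600/c) log log N`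
(the version of `rho1_le` for the corrected first interval `P₁ = (log N)^{100·6}`).
[folklore] -/
theorem rho1_le_with {c ℓ Hc : ℝ} (hc : 0 < c) (hℓ : 1 < ℓ) (hHc : 0 < Hc)
    (hK : (4 * 6 + 100 * 6 / c) * Real.log ℓ ≤ Real.log Hc) :
    Real.log (ℓ ^ (100 * 6 : ℝ)) / Real.log (Hc / ℓ ^ (4 * 6 : ℝ)) ≤ c := by
  have hℓ0 : 0 < ℓ := by linarith
  have hLL : 0 < Real.log ℓ := Real.log_pos hℓ
  rw [Real.log_rpow hℓ0, Real.log_div hHc.ne' (Real.rpow_pos_of_pos hℓ0 _).ne', Real.log_rpow hℓ0]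
  have hden : 100 * 6 / c * Real.log ℓ ≤ Real.log Hc - 4 * 6 * Real.log ℓ := by linarith
  have hden0 : 0 < 100 * 6 / c * Real.log ℓ := by positivity
  rw [div_le_iff₀ (by linarith)]
  calc (100 * 6 : ℝ) * Real.log ℓ = c * (100 * 6 / c * Real.log ℓ) := by field_simp
    _ ≤ c * (Real.log Hc - 4 * 6 * Real.log ℓ) := mul_le_mul_of_nonneg_left hden hc.le


/-- **The bound at a fixed large `X`.**  All the "X large" conditions are hypotheses; the
asymptotic theorem below discharges them eventually. [cite: Lichtman2020, §2] -/
theorem final_bound_with {C25 C22 ε : ℝ}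
    (hC25 : ∀ X h : ℕ, 1 ≤ h → ∀ P Q : ℝ, 2 ≤ P → P ≤ Q → Q ≤ X →
      (#{p ∈ Nat.primesLE X | ¬ HasPrimeFactorIn P Q (p + h)} : ℝ)
        ≤ C25 * Nat.primeCounting X * (Real.log P / Real.log Q) * ((h : ℝ) / Nat.totient h))
    (hε : 0 < ε) (X H₀ Hp : ℕ) (hHp1 : 1 ≤ Hp) (hHpH : Hp ≤ H₀) (hH₀X : H₀ ≤ X) (hX : 16 ≤ X)
    (hℓ2 : 2 ≤ Real.log ((4 * X : ℕ) : ℝ))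
    (hHpE : (Hp : ℝ) ≤ Real.exp (Real.log ((4 * X : ℕ) : ℝ) ^ ((2 : ℝ) / 3)))
    (hT : ∀ α : ℝ, ∑ k ∈ Icc 1 (4 * X), ‖moebiusTwistedSum ((Icc k (k + Hp - 1)).filter
        (lichtmanTypicalWith 100 ((4 * X : ℕ) : ℝ) 6 (1 / 6) (Hp : ℝ))) α‖
        ≤ C22 * ((Hp : ℝ) * ((4 * X : ℕ) : ℝ) / Real.log ((4 * X : ℕ) : ℝ) ^ ((6 : ℝ) / 5)))
    (hK : max (104 * 6) (4 * 6 + 100 * 6 / (ε / (4 * (max C25 0 * Real.exp 1 + 1))))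
        * Real.log (Real.log ((4 * X : ℕ) : ℝ)) ≤ Real.log (Hp : ℝ))
    (hπ : (X : ℝ) / (2 * Real.log X) ≤ Nat.primeCounting X)
    (h8 : ((4 * X : ℕ) : ℝ) / Real.log ((4 * X : ℕ) : ℝ) ^ ((6 : ℝ) / 5) ≤
        ε ^ 2 / (64 * 3 * (max C22 0 + 1)) * ((X : ℝ) / (2 * Real.log X)))
    (h9 : Real.exp (Real.log ((4 * X : ℕ) : ℝ) ^ ((2 : ℝ) / 3)) ≤
        ε ^ 2 / (64 * 3) * ((X : ℝ) / (2 * Real.log X)))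
    (hρ2 : Real.log ((4 * X : ℕ) : ℝ) ^ (2 / 3 + 1 / 6 / 2 : ℝ) /
        Real.log ((4 * X : ℕ) : ℝ) ^ (1 - 1 / 6 / 2 : ℝ) ≤ ε / (4 * (max C25 0 * Real.exp 1 + 1)))
    (hQ2 : Real.exp (Real.log ((4 * X : ℕ) : ℝ) ^ (1 - 1 / 6 / 2 : ℝ)) ≤ X) :
    ∑ h ∈ Icc 1 H₀, |moebiusShiftedPrimeSum h X| ≤ ε * ((H₀ : ℝ) * Nat.primeCounting X) := by
  -- notation (plain `have … := rfl` abbreviations are avoided: everything is explicit)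
  have hℓ1 : 1 < Real.log ((4 * X : ℕ) : ℝ) := by linarith
  have hℓ0 : 0 < Real.log ((4 * X : ℕ) : ℝ) := by linarith
  have hHp0 : (0 : ℝ) < Hp := by exact_mod_cast hHp1
  have hH1 : 1 ≤ H₀ := hHp1.trans hHpH
  -- the block structure
  have hL2 : 2 * H₀ ≤ (2 * H₀ / Hp + 1) * Hp := by
    have := Nat.lt_div_mul_add (a := 2 * H₀) (b := Hp) (by omega)
    nlinarith
  have hL3 : (2 * H₀ / Hp + 1) * Hp ≤ 3 * H₀ := by
    have := Nat.div_mul_le_self (2 * H₀) Hp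
    nlinarith
  have hL1 : 1 ≤ (2 * H₀ / Hp + 1) * Hp := by omega
  have hNL : X + (2 * H₀ / Hp + 1) * Hp ≤ 4 * X := by omega
  -- the main inequality
  have hMI := main_inequality X H₀ Hp (2 * H₀ / Hp + 1) ((2 * H₀ / Hp + 1) * Hp) (4 * X) hHp1 rfl
    hL2 hL1 hNL (lichtmanTypicalWith 100 ((4 * X : ℕ) : ℝ) 6 (1 / 6) (Hp : ℝ)) _ hT
  -- conditions on `P₁, Q₁, P₂, Q₂`
  have hP1 : (2 : ℝ) ≤ Real.log ((4 * X : ℕ) : ℝ) ^ (100 * 6 : ℝ) := by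
    calc (2 : ℝ) ≤ Real.log ((4 * X : ℕ) : ℝ) := hℓ2
      _ = Real.log ((4 * X : ℕ) : ℝ) ^ (1 : ℝ) := (Real.rpow_one _).symm
      _ ≤ _ := Real.rpow_le_rpow_of_exponent_le hℓ1.le (by norm_num)
  have hP1Q1 : Real.log ((4 * X : ℕ) : ℝ) ^ (100 * 6 : ℝ) ≤
      (Hp : ℝ) / Real.log ((4 * X : ℕ) : ℝ) ^ (4 * 6 : ℝ) := by
    rw [le_div_iff₀ (Real.rpow_pos_of_pos hℓ0 _), ← Real.rpow_add hℓ0]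
    have hK1 : (104 * 6 : ℝ) * Real.log (Real.log ((4 * X : ℕ) : ℝ)) ≤ Real.log Hp :=
      le_trans (mul_le_mul_of_nonneg_right (le_max_left _ _) (Real.log_pos hℓ1).le) hK
    calc Real.log ((4 * X : ℕ) : ℝ) ^ (100 * 6 + 4 * 6 : ℝ)
        = Real.exp (Real.log (Real.log ((4 * X : ℕ) : ℝ)) * (100 * 6 + 4 * 6)) :=
          Real.rpow_def_of_pos hℓ0 _
      _ ≤ Real.exp (Real.log Hp) := Real.exp_le_exp.mpr (by linarith)
      _ = Hp := Real.exp_log hHp0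
  have hQ1X : (Hp : ℝ) / Real.log ((4 * X : ℕ) : ℝ) ^ (4 * 6 : ℝ) ≤ X := by
    calc (Hp : ℝ) / Real.log ((4 * X : ℕ) : ℝ) ^ (4 * 6 : ℝ) ≤ Hp :=
          div_le_self hHp0.le (Real.one_le_rpow hℓ1.le (by norm_num))
      _ ≤ H₀ := by exact_mod_cast hHpH
      _ ≤ X := by exact_mod_cast hH₀X
  have hP2 : (2 : ℝ) ≤ Real.exp (Real.log ((4 * X : ℕ) : ℝ) ^ (2 / 3 + 1 / 6 / 2 : ℝ)) := by
    have h1 : (1 : ℝ) ≤ Real.log ((4 * X : ℕ) : ℝ) ^ (2 / 3 + 1 / 6 / 2 : ℝ) :=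
      Real.one_le_rpow hℓ1.le (by norm_num)
    have h2 := Real.exp_le_exp.mpr h1
    have h3 : (2 : ℝ) ≤ Real.exp 1 := by have := Real.add_one_le_exp (1 : ℝ); linarith
    linarith
  have hP2Q2 : Real.exp (Real.log ((4 * X : ℕ) : ℝ) ^ (2 / 3 + 1 / 6 / 2 : ℝ)) ≤
      Real.exp (Real.log ((4 * X : ℕ) : ℝ) ^ (1 - 1 / 6 / 2 : ℝ)) :=
    Real.exp_le_exp.mpr (Real.rpow_le_rpow_of_exponent_le hℓ1.le (by norm_num))
  -- the sieve part
  have hSS := sieve_sum_bound hC25 X H₀ hP1 hP1Q1 hQ1X hP2 hP2Q2 hQ2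
    (lichtmanTypicalWith 100 ((4 * X : ℕ) : ℝ) 6 (1 / 6) (Hp : ℝ)) (fun n => Iff.rfl)
  rw [Real.log_exp, Real.log_exp] at hSS
  have hρ1 := rho1_le_with (by positivity : 0 < ε / (4 * (max C25 0 * Real.exp 1 + 1))) hℓ1 hHp0
    (le_trans (mul_le_mul_of_nonneg_right (le_max_right _ _) (Real.log_pos hℓ1).le) hK)
  have hsieve := hSS.trans (sieve_part_small (le_max_right C25 0) hε (Nat.cast_nonneg _)
    (Nat.cast_nonneg _) hρ1 hρ2)
  -- the Fourier part
  have hJHp : (((2 * H₀ / Hp + 1 : ℕ)) : ℝ) * Hp ≤ 3 * H₀ := by exact_mod_cast hL3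
  have hL3' : ((((2 * H₀ / Hp + 1) * Hp : ℕ)) : ℝ) ≤ 3 * H₀ := by exact_mod_cast hL3
  have hT0 : C22 * ((Hp : ℝ) * ((4 * X : ℕ) : ℝ) / Real.log ((4 * X : ℕ) : ℝ) ^ ((6 : ℝ) / 5)) ≤
      max C22 0 * ((Hp : ℝ) * (((4 * X : ℕ) : ℝ) / Real.log ((4 * X : ℕ) : ℝ) ^ ((6 : ℝ) / 5))) := by
    rw [mul_div_assoc]
    exact mul_le_mul_of_nonneg_right (le_max_left _ _) (by positivity)
  have hfourier := fourier_part_small (le_max_right C22 0) hε (Nat.cast_nonneg (Nat.primeCounting X))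
    (Nat.cast_nonneg H₀) hπ (Nat.cast_nonneg _) hT0 (by positivity) hJHp hL3' hHpE hHp0.le h8 h9
  -- conclusion
  calc ∑ h ∈ Icc 1 H₀, |moebiusShiftedPrimeSum h X| ≤ _ := hMI
    _ ≤ (ε / 2) * ((H₀ : ℝ) * Nat.primeCounting X) + (ε / 2) * ((H₀ : ℝ) * Nat.primeCounting X) :=
        add_le_add hfourier hsieve
    _ = ε * ((H₀ : ℝ) * Nat.primeCounting X) := by ring


end Literature.NumberTheory.Sieve.Lichtman2020

namespace Literature.NumberTheory.Sieve

open Lichtman2020 in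
/-- **Lichtman 2020, Theorem 1.1 (qualitative part), from the key Fourier estimate along the
corrected sets `S_c` (Theorem 2.2_c, `Lichtman2020_keyFourierEstimateWith`, taken at `c = 100`) and the
sieve bound (2.5).**  The proof is that of `lichtman2020_moebius_shifted_primes_avg_of_keyFourierEstimate`
(`MoebiusShiftedPrimesProofs.lean`) with `S = S_{100}(N, 6, 1/6)`, i.e. `P₁ = (log N)^{600}`: the only
change is the sieve side, where `log P₁/log Q₁ → 0` still holds (`rho1_le_with`).  ORIGINAL DOCSTRING:  This is the paper's "Proof of Theorem 1.1 from Theorem 2.2" (§2),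
made rigorous at the boundaries: with `N = 4X`, `H' = min(H, ⌊exp((log N)^{2/3})⌋)` (the regime of
Theorem 2.2), `S = S(N, 6, 1/6)` built with `H'`, `L = (⌊2H/H'⌋ + 1) H' ∈ [2H, 3H]`:
the shifted primes with `p + h ∉ S` contribute `≪ π(X) (log P₁/log Q₁ + log P₂/log Q₂) ∑_{h≤H} h/φ(h)
= o(H π(X))` by (2.5) and `∑_{h ≤ H} h/φ(h) ≤ eH`; the others are decoupled by Lemma 2.1
(`fourier_bound`, windows of length `L`), the windows are cut into blocks of length `H'`
(`window_block_bound`), the full blocks are controlled by Theorem 2.2 in its discretised form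
(`integral_window_eq_sum`) with saving `(log N)^{6/5}`, the `≤ L` partial blocks trivially by
`L H' ≤ 3H exp((log N)^{2/3}) = o(H π(X))`, and Cauchy–Schwarz in `h` finishes:
`∑_{h ≤ H} |∑_{p ≤ X} μ(p+h)| ≤ √(4Hπ(X)(JT + LH')) + o(Hπ(X)) = o(H π(X))`, using
`π(X) ≥ X/(2 log X)` (prime number theorem, `Literature.NumberTheory.Sieve.tendsto_primeCounting_mul_log_div`).
[cite: Lichtman2020, Theorem 1.1 and §2] -/
theorem lichtman2020_moebius_shifted_primes_avg_of_keyFourierEstimateWith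
    (h22 : Lichtman2020_keyFourierEstimateWith) (h25 : Lichtman2020_shiftedPrimeSieveBound) :
    lichtman2020_moebius_shifted_primes_avg := by
  intro H hHX hH
  obtain ⟨C25, hC25⟩ := h25
  -- Theorem 2.2 along `N` with `A = 6`, `δ = 1/6` and window `H'(N) = Hcap H N`
  obtain ⟨C22, hC22⟩ := h22 100 le_rfl 6 (by norm_num) (1 / 6) (by norm_num) (Hcap H) (tendsto_log_Hcap hH)
    (Eventually.of_forall fun N => (Nat.cast_le.mpr (Hcap_le_cap H N)).trans (cap_le N))
  have h4 : Tendsto (fun X : ℕ => 4 * X) atTop atTop :=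
    tendsto_atTop_atTop.2 fun b => ⟨b, fun X hX => by omega⟩
  have hH1 := eventually_one_le_H hH
  -- the discrete key Fourier bound at `N = 4X`
  have hT : ∀ᶠ X : ℕ in atTop, ∀ α : ℝ,
      ∑ k ∈ Icc 1 (4 * X), ‖moebiusTwistedSum ((Icc k (k + Hcap H (4 * X) - 1)).filter
          (lichtmanTypicalWith 100 ((4 * X : ℕ) : ℝ) 6 (1 / 6) (Hcap H (4 * X) : ℝ))) α‖
        ≤ C22 * ((Hcap H (4 * X) : ℝ) * ((4 * X : ℕ) : ℝ) /
            Real.log ((4 * X : ℕ) : ℝ) ^ ((6 : ℝ) / 5)) := by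
    filter_upwards [h4.eventually hC22, hH1] with X hX hH1X α
    have h1 : 1 ≤ Hcap H (4 * X) := by
      rw [Hcap_four_mul]; exact le_min hH1X (one_le_cap _)
    have hconv : ∫ x in (0 : ℝ)..((4 * X : ℕ) : ℝ),
        ‖moebiusTwistedSum ((Icc ⌈x⌉₊ ⌊x + (Hcap H (4 * X) : ℝ)⌋₊).filter
          (lichtmanTypicalWith 100 ((4 * X : ℕ) : ℝ) 6 (1 / 6) (Hcap H (4 * X) : ℝ))) α‖ =
        ∑ k ∈ Icc 1 (4 * X), ‖moebiusTwistedSum ((Icc k (k + Hcap H (4 * X) - 1)).filter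
          (lichtmanTypicalWith 100 ((4 * X : ℕ) : ℝ) 6 (1 / 6) (Hcap H (4 * X) : ℝ))) α‖ :=
      integral_window_eq_sum (fun s => ‖moebiusTwistedSum (s.filter
        (lichtmanTypicalWith 100 ((4 * X : ℕ) : ℝ) 6 (1 / 6) (Hcap H (4 * X) : ℝ))) α‖)
        (4 * X) (Hcap H (4 * X)) h1
    rw [← hconv]
    exact hX α
  -- the `ε`-argument
  rw [isLittleO_iff]
  intro ε hε
  have hη0 : 0 < ε / (4 * (max C25 0 * Real.exp 1 + 1)) := by positivity
  have hc₈0 : 0 < ε ^ 2 / (64 * 3 * (max C22 0 + 1)) := by positivity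
  have hc₉0 : 0 < ε ^ 2 / (64 * 3) := by positivity
  filter_upwards [hT, hHX, hH1, eventually_log_Hcap_ge hH _, eventually_primeCounting_ge,
    eventually_main_term_le hc₈0, eventually_cap_le hc₉0, eventually_rho2_le hη0, eventually_Q2_le,
    eventually_ge_atTop 16, tendsto_log_four_mul.eventually_ge_atTop (2 : ℝ)]
    with X hTX hHXX hH1X hKX hπX h8X h9X hρ2X hQ2X hX16 hℓ2
  have hHp1 : 1 ≤ Hcap H (4 * X) := by rw [Hcap_four_mul]; exact le_min hH1X (one_le_cap _)
  have hHpH : Hcap H (4 * X) ≤ H X := by rw [Hcap_four_mul]; exact min_le_left _ _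
  have hHpE : (Hcap H (4 * X) : ℝ) ≤ Real.exp (Real.log ((4 * X : ℕ) : ℝ) ^ ((2 : ℝ) / 3)) :=
    le_trans (by exact_mod_cast Hcap_le_cap H _) (cap_le _)
  rw [Real.norm_of_nonneg (Finset.sum_nonneg fun _ _ => abs_nonneg _),
    Real.norm_of_nonneg (by positivity)]
  exact final_bound_with hC25 hε X (H X) (Hcap H (4 * X)) hHp1 hHpH hHXX hX16 hℓ2 hHpE hTX hKX hπX
    h8X h9X hρ2X hQ2X


open Lichtman2020 in
/-- **Theorem 1.1 (qualitative part) from Theorem 2.2_c**, the sieve bound (2.5) being the proved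
`Lichtman2020_shiftedPrimeSieveBound_holds`. [cite: Lichtman2020, Theorem 1.1] -/
theorem lichtman2020_moebius_shifted_primes_avg_of_keyFourierEstimateWith'
    (h22 : Lichtman2020_keyFourierEstimateWith) : lichtman2020_moebius_shifted_primes_avg :=
  lichtman2020_moebius_shifted_primes_avg_of_keyFourierEstimateWith h22
    Lichtman2020_shiftedPrimeSieveBound_holds

open Lichtman2020 in
/-- **Theorem 1.1 (qualitative part) from Proposition 5.1_c and Lemma 4.8** (minor arcs
`Lichtman2020_minorArcEstimateWith_holds`, Prop 3.4_c ⇐ 5.1_c + 4.8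
`Lichtman2020_liouvilleMeanSquareWith_of_dirichletMeanValueWith`, the arcs and Thm 2.2_c
`Lichtman2020_keyFourierEstimateWith_of_minorArc_of_liouvilleMeanSquareWith`). [cite: Lichtman2020, Theorem 1.1] -/
theorem lichtman2020_moebius_shifted_primes_avg_of_dirichletMeanValueWith
    (h51 : Lichtman2020_dirichletMeanValueWith) (h48 : Lichtman2020_liouvilleCharacterSifted) :
    lichtman2020_moebius_shifted_primes_avg :=
  lichtman2020_moebius_shifted_primes_avg_of_keyFourierEstimateWith'
    (Lichtman2020_keyFourierEstimateWith_of_minorArc_of_liouvilleMeanSquareWith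
      Lichtman2020_minorArcEstimateWith_holds
      (Lichtman2020_liouvilleMeanSquareWith_of_dirichletMeanValueWith h51 h48))

/-- **Lichtman 2020, Theorem 1.1 (qualitative part), conditional on exactly Lemma 4.5 and Lemma 4.8
of the paper** (`Lichtman2020_primeCharacterSum`, `Lichtman2020_liouvilleCharacterSifted`): all other
steps are proved in the tree along the corrected typical sets `S_c`
(Prop 5.1_c ⇐ Lemma 4.5: `Lichtman2020_dirichletMeanValueWith_of_primeCharacterSum`).
[cite: Lichtman2020, Theorem 1.1] -/
theorem lichtman2020_moebius_shifted_primes_avg_of_primeCharacterSum_of_liouvilleCharacterSifted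
    (h45 : Lichtman2020_primeCharacterSum) (h48 : Lichtman2020_liouvilleCharacterSifted) :
    lichtman2020_moebius_shifted_primes_avg :=
  lichtman2020_moebius_shifted_primes_avg_of_dirichletMeanValueWith
    (Lichtman2020_dirichletMeanValueWith_of_primeCharacterSum h45) h48

end Literature.NumberTheory.Sieve
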